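import Summits.HodgeConjecture.HodgeConjecture.Theorems.LinearSystemTorelliDivisorInduction
import Summits.HodgeConjecture.HodgeConjecture.Theorems.LinearSystemTorelliUnsupportedHodgeClassFourfold
import Summits.HodgeConjecture.HodgeConjecture.Theorems.LinearSystemTorelliMiddleDivisorSupportFourfoldPairingSplit

/-!
# Route `LinearSystemTorelli` — crux `MiddleDivisorSupportFourfold` (stmt-HodgeConjecture-2409):
# the crux is HC(4,2), and so is the divisor-visibility statement of line `Sketch`

Helper file for the crux item stmt-HodgeConjecture-2409 (`--supports`; it closes nothing). It
records, kernel-checked and modulo NAMED LITERATURE FACTS ONLY (all theorems in print), the exact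
strength of the crux and of the "bet" of the crux line `Sketch`
(`Cruxes/MiddleDivisorSupportFourfold/Lines/Sketch.lean`, de Cataldo–Migliorini arXiv:0711.1307 §4):

* `linearSystemTorelli_hc42_of_middleDivisorSupportFourfold` — crux ⟹ HC(4,2) (every rational
  `(2,2)`-class on a smooth projective complex fourfold is algebraic, `∈ algebraicClasses X 2`),
  modulo Deligne Hodge III Cor. 8.2.8 (`Deligne1974_ker_restrictCompl_eq_iSup_range_complexGysin`),
  Voisin 2025 Cor. 2.12 (`Voisin2025_hodgeClass_lift_complexGysin`, the semisimplicity lift of Hodge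
  classes along Gysin morphisms) — these two give the route item `DivisorInduction`
  (`linearSystemTorelli_divisorInduction_of_deligne_of_hodgeClassLift`) — and Lefschetz `(1,1)`
  (`lefschetzOneOne_rational`, which is HC(3,1) on the resolved components of the supporting
  divisor). This is the logic of the route's former support `FunnelFourfold` (Thomas 2005 Thm. 1 /
  BFNP Thm. 52 with `n = 2`).
* `linearSystemTorelli_middleDivisorSupportFourfold_of_hc42` — HC(4,2) ⟹ crux, unconditionally
  (`Alg² = N²H⁴ ≤ N¹H⁴`, `supportedClasses_mono`).
* `linearSystemTorelli_middleDivisorSupportFourfold_iff_hc42` — the equivalence.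
* `linearSystemTorelli_unsupportedHodgeClassFourfold_iff_exists_not_mem_algebraicClasses` — hence the
  negative-side item `UnsupportedHodgeClassFourfold` (stmt-HodgeConjecture-2413, `¬` crux) is EXACTLY the
  existence of a non-algebraic rational `(2,2)`-class on some smooth projective fourfold: a refuter's
  witness must be a counterexample to the Hodge conjecture for fourfolds.
* `linearSystemTorelli_middleDivisorSupportFourfold_iff_visibleOnDivisors` — modulo, in addition,
  BFNP (6.1) on threefolds and on fourfolds (`hodgeClasses_cupPairing_nondegenerate 3 Y`, `… 4 X`:
  hard Lefschetz + Hodge–Riemann), the crux is equivalent to the DIVISOR-VISIBILITY statement of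
  line `Sketch` (its stub `VisibleOnDivisors`, written out): every non-zero rational `(2,2)`-class
  that is cup-orthogonal to `Alg²(X) = supportedClasses X 4 2` pairs non-trivially with a class
  supported on some Zariski-closed `Z` of codimension `≥ 1`. "⇐" composes the landed reductions
  `linearSystemTorelli_middleDivisorSupportFourfold_threefoldDetection_of` (p105436) and
  `…_pairingSplit_of_deligne` (p103138); "⇒" is vacuous through HC(4,2) and (6.1) on the fourfold
  (a non-zero rational `(2,2)`-class has a rational `(2,2)` cup-partner, which is algebraic).

Consequence recorded for the crux chain: the line `Sketch` REDUCES THE CRUX TO ITSELF — modulo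
theorems in print its only stub of mathematical content is equivalent to the crux (= the Hodge
conjecture for fourfolds in codimension two). No new definition, no new named fact, no `sorry`.
-/

noncomputable section

namespace Summit.HodgeConjecture.HodgeConjecture.Theorems

open Summit.HodgeConjecture.HodgeConjecture.Theses.LinearSystemTorelli
open Literature.AlgebraicGeometry Literature.AlgebraicGeometry.HodgeTheory
open Literature.AlgebraicGeometry.Motives
open Literature.AlgebraicTopology.SingularHomology

/-- **crux ⟹ HC(4,2)** modulo Deligne 8.2.8 (`hD`), Voisin 2025 Cor. 2.12 (`hB`) and Lefschetz
`(1,1)` (`hL`): a rational `(2,2)`-class `c` on a smooth projective fourfold is divisor-supported by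
the crux, hence algebraic by divisor induction at `(n, p) = (3, 2)`
(`linearSystemTorelli_divisorInduction_of_deligne_of_hodgeClassLift hD hB 3 2`) from HC(3,1), which
is Lefschetz `(1,1)` on threefolds. [cite: Thomas2005Nodes, Thm. 1 and §2]
[cite: BrosnanFangNiePearlstein2009, Thm. 52] [cite: DeligneHodgeIII1974, Cor. 8.2.8]
[cite: Voisin2025, Cor. 2.12] [cite: VoisinHodgeI2002, Thm. 11.30] -/
theorem linearSystemTorelli_hc42_of_middleDivisorSupportFourfold
    (hD : Deligne1974_ker_restrictCompl_eq_iSup_range_complexGysin)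
    (hB : Voisin2025_hodgeClass_lift_complexGysin) (hL : lefschetzOneOne_rational)
    (h : MiddleDivisorSupportFourfold) :
    ∀ ⦃X : SchemeOver ℂ⦄, IsSmoothProjective 4 X →
      ∀ c : complexBetti X 4, IsRationalClass c → IsOfHodgeType 4 X 4 2 2 c →
        c ∈ algebraicClasses X 2 := by
  intro X hX c hc hh
  exact linearSystemTorelli_divisorInduction_of_deligne_of_hodgeClassLift hD hB 3 2 (by norm_num)
    (fun Y hY c' hc' hh' => hL hY c' hc' hh') hX c hc hh (h hX c hc hh)

/-- **HC(4,2) ⟹ crux**, unconditionally: an algebraic class lies in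
`algebraicClasses X 2 = N²H⁴ ≤ N¹H⁴ = supportedClasses X 4 1` (`supportedClasses_mono`).
[cite: GrothendieckTopology1969, §1] -/
theorem linearSystemTorelli_middleDivisorSupportFourfold_of_hc42
    (h : ∀ ⦃X : SchemeOver ℂ⦄, IsSmoothProjective 4 X →
      ∀ c : complexBetti X 4, IsRationalClass c → IsOfHodgeType 4 X 4 2 2 c →
        c ∈ algebraicClasses X 2) :
    MiddleDivisorSupportFourfold :=
  fun X hX c hc hh => supportedClasses_mono X 4 (by norm_num : 1 ≤ 2) (h hX c hc hh)

/-- **The crux `MiddleDivisorSupportFourfold` is the Hodge conjecture for fourfolds in codimension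
two**, modulo Deligne 8.2.8, Voisin 2025 Cor. 2.12 and Lefschetz `(1,1)` (only "⇒" uses them).
[cite: Thomas2005Nodes, Thm. 1] [cite: BrosnanFangNiePearlstein2009, Thm. 52]
[cite: DeligneHodgeIII1974, Cor. 8.2.8] [cite: Voisin2025, Cor. 2.12] -/
theorem linearSystemTorelli_middleDivisorSupportFourfold_iff_hc42
    (hD : Deligne1974_ker_restrictCompl_eq_iSup_range_complexGysin)
    (hB : Voisin2025_hodgeClass_lift_complexGysin) (hL : lefschetzOneOne_rational) :
    MiddleDivisorSupportFourfold ↔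
      ∀ ⦃X : SchemeOver ℂ⦄, IsSmoothProjective 4 X →
        ∀ c : complexBetti X 4, IsRationalClass c → IsOfHodgeType 4 X 4 2 2 c →
          c ∈ algebraicClasses X 2 :=
  ⟨linearSystemTorelli_hc42_of_middleDivisorSupportFourfold hD hB hL,
    linearSystemTorelli_middleDivisorSupportFourfold_of_hc42⟩

/-- **The negative-side item `UnsupportedHodgeClassFourfold` (stmt-HodgeConjecture-2413) is exactly
a counterexample to HC(4,2)**, modulo Deligne 8.2.8, Voisin 2025 Cor. 2.12 and Lefschetz `(1,1)`: a
smooth projective fourfold with a rational `(2,2)`-class off a divisor is the same as one with a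
NON-ALGEBRAIC rational `(2,2)`-class (a refuter's witness must disprove the Hodge conjecture for
fourfolds; no cheaper witness exists). [cite: Thomas2005Nodes, Thm. 1]
[cite: BrosnanFangNiePearlstein2009, Thm. 52] -/
theorem linearSystemTorelli_unsupportedHodgeClassFourfold_iff_exists_not_mem_algebraicClasses
    (hD : Deligne1974_ker_restrictCompl_eq_iSup_range_complexGysin)
    (hB : Voisin2025_hodgeClass_lift_complexGysin) (hL : lefschetzOneOne_rational) :
    UnsupportedHodgeClassFourfold ↔
      ∃ (X : SchemeOver ℂ) (_ : IsSmoothProjective 4 X) (c : complexBetti X 4),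
        IsRationalClass c ∧ IsOfHodgeType 4 X 4 2 2 c ∧ c ∉ algebraicClasses X 2 := by
  rw [linearSystemTorelli_unsupportedHodgeClassFourfold_iff,
    linearSystemTorelli_middleDivisorSupportFourfold_iff_hc42 hD hB hL]
  constructor
  · intro h
    by_contra hne
    refine h fun X hX c hc hh => ?_
    by_contra hc2
    exact hne ⟨X, hX, c, hc, hh, hc2⟩
  · rintro ⟨X, hX, c, hc, hh, hc2⟩ h
    exact hc2 (h hX c hc hh)

end Summit.HodgeConjecture.HodgeConjecture.Theorems

end
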